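import Summits.BirchSwinnertonDyer.BirchSwinnertonDyer.Theorems.AdditiveBranchIMCGordTwoRankOneHeegnerKolyvaginItem
import Summits.BirchSwinnertonDyer.Rank1Residual.X11b.TwistTransportIrr
import Literature.NumberTheory.EllipticCurves.Kato2004.AdditivePotGoodRankZeroShaUpperBoundFineSelmer
import HarnessLib

/-!
# Route `AdditiveBranchIMC` (rung K1), crux `GordTwoRankOne` (item 19358): the Heegner–Kolyvagin road,
# Part 14 — the SMALL-IMAGE rows (`E[p]` irreducible, `ρ̄_{E,p^n}` not onto for some `n`: the O8 rows of
# the cell and the 3-adic tower defects): the road is IMAGE-FREE on the rank-one side; the image enters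
# only through the rank-zero twist's upper bound, supplied here by Kato 2004 for IRREDUCIBLE `E[p]`
# GRANTED Coates–Sujatha's Conjecture A at the twist (lane `bsd-addord-k1-c3x`, gen 2; `--supports` only)

HONEST FRAMING. THEOREMS ONLY: no definition, no new named fact, no `sorry`; nothing is booked; the crux
stays OPEN; «BSD is not proved by any of this». So far lane B displayed the crux on every non-CM row that is
not tower-surjective (`hRest`). But the road's LOWER-half door (Part 8,
`missingLowerBoundAt_of_adjustedIndexBound`) has NO image hypothesis at all: at a Heegner datum it needs
only STEP L′ and the `≤`-half of the rank-ZERO twist `Wd = E^{d_K}` in Kato's shape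
(`ord_p #Ш(Wd) + ord_p ∏c(Wd) − 2·ord_p #Wd(ℚ)_tors ≤ ord_p L(Wd,1)/Ω`). On the tower-surjective rows that
half is Kato 2004 Thm 14.5 (3) (tree fact `…_of_imageContainsSL2`). On the rows with `E[p]` IRREDUCIBLE but
`ρ̄` not (tower-)surjective — where the printed big-image hypotheses are FALSE (barrier
`Literature/Barriers/BirchSwinnertonDyer/EulerSystemBigImageAtSmallImage`) — the tree carries Kato's bound
in the reading `Kato2004.rankZero_padicValNat_sha_add_padicValNat_tamagawa_le_of_additive_potGood_of_irreducible_of_fineSelmerDual_fg`: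
Tamagawa-exact, ANY image size, GRANTED the `ℤ_p`-finite generation of the dual fine Selmer group
`Y(Wd/ℚ^cyc)` (Coates–Sujatha 2005, Conjecture A at `(Wd, p)` — an OPEN hypothesis, displayed, never
asserted). THIS FILE:

* §27 `twist_le_half_of_katoIrreducible_of_fineSelmerFG` — the twist's `≤`-half from that fact.
* §28 `missingLowerBoundAt_rankOne_additive_of_adjustedIndexBound_of_irr` — the POINTWISE lower half at an
  additive potentially good `p` for `E[p]` irreducible (any image): PUB + STEP L′ at the datum + Conjecture A
  at `(Wd, p)`.
* §29 `cellGordTwo_missingLowerBoundAt_rankOne_of_smallImage_of_adjustedIndexBound_of_conjA` — CLASS LEVEL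
  on the small-image rows (`Irr W p`, not tower-surjective): PUB + STEP L′ on those rows (`hLsm`, the
  small-image companion of item 20498; same body with `Irr ∧ ¬towerSurj` for `towerSurj`) + Conjecture A at
  their Friedberg–Hoffstein twists (`hAsm`).
* §30 `gordTwoRankOne_of_item_of_smallImage_of_red` — the crux BY NAME with the complement SHRUNK to the
  REDUCIBLE rows: item 20498 (tower-surjective rows) + `hLsm` + `hAsm` (small-image rows) + Li–Liu–Tian (CM)
  + the crux DISPLAYED on the non-CM rows with `E[p]` REDUCIBLE (X3♯ — lane A's Greenberg–Vatsal /
  Wuthrich-half road) ⟹ `GordTwoRankOne`.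

README §1 row B7/O8 («additive × small image: untouched by every printed statement; CONSTRUCTION = B2/B4
object × A4's object») thus gets, on its rank-one (G-ord, `e = 2`) rows, a typed road with TWO named open
inputs: STEP L′ (Heegner–Kolyvagin side, image-free) and Conjecture A at the rank-zero twist (the
small-image input, weaker than `μ = 0` for the full Selmer group). Nothing booked; an honest split.

References: [JetchevSkinnerWan2017] §7.4.1; [Kato2004Asterisque] Thm. 12.5 (3)–(4), 13.4, 14.5 (3),
Prop. 14.16 (2); [CoatesSujatha2005] statement (A); [Lim2017FineSelmer] §3; [Wuthrich2014] Lemma 14,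
Prop. 15; [Miller2011LMS] Def. 1.1.
-/

set_option autoImplicit false
set_option linter.dupNamespace false
noncomputable section

open scoped Classical NumberField
open WeierstrassCurve NumberField IsDedekindDomain
  Literature.NumberTheory.EllipticCurves Literature.NumberTheory.EllipticCurves.ModularForms
  Literature.NumberTheory.EllipticCurves.Rank1Residual
  Literature.NumberTheory.EllipticCurves.Rank1Residual.Typed
  Summit.BirchSwinnertonDyer.Rank1Residual
  Summit.BirchSwinnertonDyer.Rank1Residual.Additive
  Summit.BirchSwinnertonDyer.Rank1Residual.X11b
  Summit.BirchSwinnertonDyer.Rank1Residual.GaloisImage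
  Literature.NumberTheory.Automorphic
  Summit.BirchSwinnertonDyer.BirchSwinnertonDyer.Theses.AdditiveBranchIMC

namespace Summit.BirchSwinnertonDyer.BirchSwinnertonDyer.Theorems.AdditiveBranchIMCGordTwoRankOne.HeegnerKolyvagin

/-! ### §27 The twist's `≤`-half for IRREDUCIBLE `E[p]`, granted Conjecture A at the twist -/

/-- **Kato's upper bound for the rank-zero twist in Jetchev–Skinner–Wan's shape, irreducible image of ANY
size, GRANTED Conjecture A.** For `Wd/ℚ` globally minimal, `p ≠ 2` additive potentially good
(`Addv Wd p`, `0 ≤ ord_p j`), `Wd[p]` irreducible, `L(Wd,1) ≠ 0` (GZK for finiteness of `Ш`), and the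
`ℤ_p`-finite generation of the dual fine Selmer group over `ℚ^cyc` (`hA`, Coates–Sujatha's (A) at `(Wd,p)`):
`∃ q, L(Wd,1)/Ω = q ∧ ord_p #Ш(Wd) + ord_p ∏c(Wd) − 2·ord_p #Wd(ℚ)_tors ≤ ord_p q` — the binder `htw` of
Part 8's `missingLowerBoundAt_of_adjustedIndexBound`. The companion of Part 1's
`twist_le_half_of_katoTamagawaExact` (tower-surjective image) on the small-image rows.
[cite: Kato2004Asterisque, Thm. 12.5 (3)–(4) (p. 222), Thm. 14.5 (3) (p. 236), Prop. 14.16 (2) (p. 244)]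
[cite: CoatesSujatha2005, statement (A) (introduction and §3)] [cite: JetchevSkinnerWan2017, §7.4.2 (p. 31)] -/
theorem twist_le_half_of_katoIrreducible_of_fineSelmerFG
    (hKatoI : Kato2004.rankZero_padicValNat_sha_add_padicValNat_tamagawa_le_of_additive_potGood_of_irreducible_of_fineSelmerDual_fg)
    (hGZK : rank_eq_analyticRank_of_analyticRank_le_one) (hmod : hasEntireLFunction_rat)
    (Wd : WeierstrassCurve ℚ) [Wd.IsElliptic] [Wd.IsGloballyMinimal] (p : ℕ) [Fact p.Prime]
    (hp2 : p ≠ 2) (hadd : Addv Wd p) (hj : 0 ≤ padicValRat p Wd.j)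
    (hirr : Wd.HasIrreducibleModPGaloisRep p)
    (hA : ∀ κ : ZpExtension ℚ p, κ.IsCyclotomic →
      ∃ (γ : Field.absoluteGaloisGroup ℚ) (D : Wd.FineSelmerDualData κ γ),
        Module.Finite ℤ_[p] (RestrictScalars ℤ_[p] (IwasawaAlgebra p) D.X))
    (hL : Wd.entireLFunction 1 ≠ 0) :
    ∃ q : ℚ, Wd.entireLFunction 1 / (Wd.realPeriodRat : ℂ) = (q : ℂ) ∧
      (padicValNat p Wd.shaOrder : ℤ) + padicValNat p Wd.tamagawaProduct -
        2 * padicValNat p Wd.torsionOrder ≤ padicValRat p q := by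
  have hrd : Wd.analyticRank = 0 := (Wd.analyticRank_eq_zero_iff_holds (hmod Wd)).2 hL
  haveI hfin : Finite Wd.sha := (hGZK Wd (by rw [hrd]; exact zero_le_one)).2
  obtain ⟨q, hq, hle⟩ := hKatoI Wd p hp2 hadd.1 hadd.2 hj hirr hA hL hfin
  refine ⟨q, hq, ?_⟩
  have hsha : padicValNat p (Nat.card (AddCommGroup.primaryComponent Wd.sha p)) =
      padicValNat p Wd.shaOrder := by
    unfold WeierstrassCurve.shaOrder
    exact padicValNat_card_addPrimaryComponent p
  rw [← hsha]
  have h0 : (0 : ℤ) ≤ 2 * padicValNat p Wd.torsionOrder := by positivity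
  linarith

/-! ### §28 The pointwise lower half on IRREDUCIBLE image (any size) -/

/-- **THE POINTWISE LOWER HALF at an additive potentially good prime for `E[p]` IRREDUCIBLE of any image
size** — Part 8's `missingLowerBoundAt_rankOne_additive_of_adjustedIndexBound` with tower-surjectivity
replaced by irreducibility + Conjecture A at the twist. Data: `W/ℚ` globally minimal, `ord_{s=1} L(E,s) = 1`,
`p` odd, `Addv W p`, `0 ≤ ord_p j`, `E[p]` irreducible; Heegner data (`K`, `Dt`, `H`, `ι`, `P`;
`p ∤ #𝓞_K^×`, `L(E^{d_K},1) ≠ 0`); `Wd = Cd • W^{(d_K)}` globally minimal — again additive potentially good at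
`p` with `Wd[p]` irreducible (Part 1 `addv_twist_of_heegner`, x11b `hasIrreducibleModPGaloisRep_twist_model`).
PUBLISHED binders `hGZ`, `hKo`, `hKatoI`, `hGZK`, `hmod`. OPEN inputs: `hA` (Conjecture A at `(Wd,p)`) and
`hL'` (STEP L′ at the datum). CONCLUSION: `Typed.MissingLowerBoundAt W p`.
[cite: JetchevSkinnerWan2017, §7.4.1 (pp. 29–31)] [cite: Kato2004Asterisque, Thm. 14.5 (3) (p. 236) and Prop. 14.16 (2)]
[cite: CoatesSujatha2005, statement (A)] [cite: Miller2011LMS, Def. 1.1] -/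
theorem missingLowerBoundAt_rankOne_additive_of_adjustedIndexBound_of_irr
    (W : WeierstrassCurve ℚ) [W.IsElliptic] [W.IsGloballyMinimal] (p : ℕ) [Fact p.Prime]
    [NeZero (W.conductorNorm ℤ)] (K : Type) [Field K] [NumberField K]
    (Dt : ModularParametrizationData W (W.conductorNorm ℤ))
    (H : HeegnerDatum (W.conductorNorm ℤ) (NumberField.discr K)) (ι : K →+* ℂ)
    (P : (W.baseChange K).toAffine.Point)
    (hGZ : gross_zagier (W.conductorNorm ℤ) W K) (hKo : kolyvagin (W.conductorNorm ℤ) W K)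
    (hKatoI : Kato2004.rankZero_padicValNat_sha_add_padicValNat_tamagawa_le_of_additive_potGood_of_irreducible_of_fineSelmerDual_fg)
    (hGZK : rank_eq_analyticRank_of_analyticRank_le_one) (hmod : hasEntireLFunction_rat)
    (hr : W.analyticRank = 1) (hp2 : p ≠ 2) (hadd : Addv W p) (hj : 0 ≤ padicValRat p W.j)
    (hirr : W.HasIrreducibleModPGaloisRep p)
    (hK : IsImaginaryQuadratic K) (hHN : SatisfiesHeegnerHypothesis (W.conductorNorm ℤ) K)
    (hP : WeierstrassCurve.Affine.Point.map ι.toRatAlgHom P = heegnerPointComplex Dt H)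
    (hμ : ¬ p ∣ Units.torsionOrder K)
    (hLt : (W.quadraticTwist (NumberField.discr K : ℚ)).entireLFunction 1 ≠ 0)
    (Wd : WeierstrassCurve ℚ) [Wd.IsElliptic] [Wd.IsGloballyMinimal] (Cd : VariableChange ℚ)
    (hWd : Cd • W.quadraticTwist (NumberField.discr K : ℚ) = Wd)
    (hA : ∀ κ : ZpExtension ℚ p, κ.IsCyclotomic →
      ∃ (γ : Field.absoluteGaloisGroup ℚ) (D : Wd.FineSelmerDualData κ γ),
        Module.Finite ℤ_[p] (RestrictScalars ℤ_[p] (IwasawaAlgebra p) D.X))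
    (hL' : Finite (W.baseChange K).sha →
      (2 * padicValNat p (AddSubgroup.zmultiples P).index : ℤ) ≤
        padicValNat p (W.baseChange K).shaOrder + padicValNat p W.tamagawaProduct +
          padicValNat p Wd.tamagawaProduct + 2 * padicValRat p (Dt.c : ℚ)) :
    Typed.MissingLowerBoundAt W p := by
  have hD0 : (NumberField.discr K : ℚ) ≠ 0 := by exact_mod_cast NumberField.discr_ne_zero K
  haveI hEt : (W.quadraticTwist (NumberField.discr K : ℚ)).IsElliptic := W.isElliptic_quadraticTwist hD0
  have haddd : Addv Wd p := addv_twist_of_heegner W p K hK hHN hadd Cd hWd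
  have hjd : 0 ≤ padicValRat p Wd.j := by
    have hjeq : Wd.j = W.j := by subst hWd; rw [variableChange_j, W.j_quadraticTwist hD0]
    rw [hjeq]; exact hj
  have hirrd : Wd.HasIrreducibleModPGaloisRep p := hasIrreducibleModPGaloisRep_twist_model W p K hK.1 hirr Cd hWd
  have hu : padicValRat p (Cd.u : ℚ) = 0 :=
    padicValRat_u_eq_zero_of_twist_minimal' W p K hK hHN hadd.1 Cd hWd
  have hLd1 : Wd.entireLFunction 1 ≠ 0 := twistModel_entireLFunction_one_ne_zero W K hLt Wd Cd hWd
  have htw := twist_le_half_of_katoIrreducible_of_fineSelmerFG hKatoI hGZK hmod Wd p hp2 haddd hjd hirrd hA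
    hLd1
  exact missingLowerBoundAt_of_adjustedIndexBound W p (W.conductorNorm ℤ) K Dt H ι P hGZ hKo hGZK hmod hK hHN
    hP hp2 hμ hr hLt Wd Cd hWd hu htw hL'

/-! ### §29 Class level on the small-image rows (`E[p]` irreducible, not tower-surjective) -/

/-- **Crux `GordTwoRankOne`'s conclusion on the SMALL-IMAGE rows of cell (G-ord, `e = 2`) — `E[p]`
irreducible but `ρ̄_{E,p^n}` not onto for some `n` (O8 rows at `p ≥ 5`: images `5S4 / 5Ns / 5Nn / 7Ns /
13S4`; 3-adic tower defects at `p = 3`) — from PUBLISHED facts and TWO typed OPEN inputs.** PUBLISHED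
binders: `hGZ`, `hKo`, `hKatoI` (Kato 2004 at an additive potentially good prime for irreducible `E[p]`,
Tamagawa-exact, fine-Selmer reading), `hGZK`, `hmod`, `hnf`, `hmodP`, `hFH` (Friedberg–Hoffstein). OPEN
inputs: `hLsm` — STEP L′ at the Heegner data of those rows (the body of item 20498 with «tower-surjective»
replaced by «irreducible, not tower-surjective»); `hAsm` — Coates–Sujatha's Conjecture A for the
Friedberg–Hoffstein twists `Wd` of those rows at `p` (dual fine Selmer group over `ℚ^cyc` finitely generated
over `ℤ_p`). CONCLUSION: `Typed.MissingLowerBoundAt W p` on every such rank-one pair. The Heegner–Kolyvagin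
side is image-free; the image enters only through Kato's bound for the rank-zero twist. Nothing booked.
[cite: JetchevSkinnerWan2017, §7.4.1 (pp. 29–31)] [cite: Kato2004Asterisque, Thm. 14.5 (3) (p. 236) and Prop. 14.16 (2)]
[cite: CoatesSujatha2005, statement (A)] [cite: Miller2011LMS, Def. 1.1] -/
theorem cellGordTwo_missingLowerBoundAt_rankOne_of_smallImage_of_adjustedIndexBound_of_conjA
    (hGZ : ∀ (N : ℕ) [NeZero N] (W : WeierstrassCurve ℚ) (K : Type) [Field K] [NumberField K],
      gross_zagier N W K)
    (hKo : ∀ (N : ℕ) [NeZero N] (W : WeierstrassCurve ℚ) (K : Type) [Field K] [NumberField K],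
      kolyvagin N W K)
    (hKatoI : Kato2004.rankZero_padicValNat_sha_add_padicValNat_tamagawa_le_of_additive_potGood_of_irreducible_of_fineSelmerDual_fg)
    (hGZK : rank_eq_analyticRank_of_analyticRank_le_one) (hmod : hasEntireLFunction_rat)
    (hnf : exists_isNewformOf) (hmodP : nonempty_modularParametrizationData)
    (hFH : friedbergHoffstein_exists_heegnerField_split_twist_ne_zero)
    (hLsm : ∀ (W : WeierstrassCurve ℚ) [W.IsElliptic] [W.IsGloballyMinimal] (p : ℕ) [Fact p.Prime]
      (N : ℕ) [NeZero N] (K : Type) [Field K] [NumberField K]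
      (Dt : ModularParametrizationData W N) (H : HeegnerDatum N (NumberField.discr K)) (ι : K →+* ℂ)
      (P : (W.baseChange K).toAffine.Point)
      (Wd : WeierstrassCurve ℚ) [Wd.IsElliptic] [Wd.IsGloballyMinimal] (Cd : VariableChange ℚ),
      W.analyticRank = 1 → N10.CellGordTwo W p → W.HasIrreducibleModPGaloisRep p →
      ¬ (∀ n : ℕ, W.HasSurjectiveModNGaloisRep (p ^ n : ℕ)) →
      W.conductorNorm ℤ = N → IsImaginaryQuadratic K → SatisfiesHeegnerHypothesis N K →
      WeierstrassCurve.Affine.Point.map ι.toRatAlgHom P = heegnerPointComplex Dt H →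
      Cd • W.quadraticTwist (NumberField.discr K : ℚ) = Wd →
      Finite (W.baseChange K).sha →
      (2 * padicValNat p (AddSubgroup.zmultiples P).index : ℤ) ≤
        padicValNat p (W.baseChange K).shaOrder + padicValNat p W.tamagawaProduct +
          padicValNat p Wd.tamagawaProduct + 2 * padicValRat p (Dt.c : ℚ))
    (hAsm : ∀ (W : WeierstrassCurve ℚ) [W.IsElliptic] [W.IsGloballyMinimal] (p : ℕ) [Fact p.Prime]
      (K : Type) [Field K] [NumberField K]
      (Wd : WeierstrassCurve ℚ) [Wd.IsElliptic] [Wd.IsGloballyMinimal] (Cd : VariableChange ℚ),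
      W.analyticRank = 1 → N10.CellGordTwo W p → W.HasIrreducibleModPGaloisRep p →
      ¬ (∀ n : ℕ, W.HasSurjectiveModNGaloisRep (p ^ n : ℕ)) →
      IsImaginaryQuadratic K → SatisfiesHeegnerHypothesis (W.conductorNorm ℤ) K →
      (W.quadraticTwist (NumberField.discr K : ℚ)).entireLFunction 1 ≠ 0 →
      Cd • W.quadraticTwist (NumberField.discr K : ℚ) = Wd →
      ∀ κ : ZpExtension ℚ p, κ.IsCyclotomic →
        ∃ (γ : Field.absoluteGaloisGroup ℚ) (D : Wd.FineSelmerDualData κ γ),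
          Module.Finite ℤ_[p] (RestrictScalars ℤ_[p] (IwasawaAlgebra p) D.X)) :
    ∀ (W : WeierstrassCurve ℚ) [W.IsElliptic] [W.IsGloballyMinimal] (p : ℕ) [Fact p.Prime],
      W.analyticRank = 1 → N10.CellGordTwo W p → W.HasIrreducibleModPGaloisRep p →
      ¬ (∀ n : ℕ, W.HasSurjectiveModNGaloisRep (p ^ n : ℕ)) → Typed.MissingLowerBoundAt W p := by
  intro W _ _ p _ hr hc2 hirr hns
  have hp : p.Prime := Fact.out
  obtain ⟨hp2, hadd, hG, he⟩ := hc2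
  haveI : NeZero (W.conductorNorm ℤ) := ⟨(W.conductorNorm_pos_holds).ne'⟩
  have hj : 0 ≤ padicValRat p W.j := not_lt.mp (N10.not_potMult_of_typeGOrd W p hp2 hadd hG)
  -- the sign of the functional equation is `−1` (modularity, `r_an = 1`)
  have hw : W.rootNumber = -1 := by
    rw [WeierstrassCurve.rootNumber_eq_neg_one_pow_analyticRank_of_exists_isNewformOf hnf W, hr]
    norm_num
  -- the auxiliary field (Friedberg–Hoffstein): every `ℓ ∣ N` split, `|d_K| > 4`, `L(E^{d_K},1) ≠ 0`
  obtain ⟨K, _, _, hK, hdisc, hHN, -, hLt⟩ := hFH W hw p hp 4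
  have hpN : p ∣ W.conductorNorm ℤ := (W.dvd_conductorNorm_iff_not_hasGoodReductionAtPrime p).mpr hadd.1
  have hμ : ¬ p ∣ Units.torsionOrder K := not_dvd_unitsTorsionOrder_of_heegner hK hHN hp hp2 hpN
  -- the Heegner datum and a minimal twist model
  obtain ⟨Dt⟩ := hmodP W
  obtain ⟨β, hβ⟩ := exists_dvd_sq_sub_discr_holds (W.conductorNorm ℤ) K hK hHN
  obtain ⟨H, -⟩ := nonempty_heegnerDatum_holds (W.conductorNorm ℤ) K hK hβ
  obtain ⟨ι⟩ : Nonempty (K →+* ℂ) := inferInstance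
  obtain ⟨P, hP⟩ := heegnerPointComplex_mem_range_map_holds (W.conductorNorm ℤ) W K hK hHN Dt H ι
  have hD0 : (NumberField.discr K : ℚ) ≠ 0 := by exact_mod_cast NumberField.discr_ne_zero K
  haveI hEt : (W.quadraticTwist (NumberField.discr K : ℚ)).IsElliptic :=
    W.isElliptic_quadraticTwist hD0
  obtain ⟨Cd, hCd⟩ := hasGlobalMinimalModel_rat_holds (W.quadraticTwist (NumberField.discr K : ℚ))
  haveI : (Cd • W.quadraticTwist (NumberField.discr K : ℚ)).IsGloballyMinimal := hCd
  have hWd : Cd • W.quadraticTwist (NumberField.discr K : ℚ) =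
      Cd • W.quadraticTwist (NumberField.discr K : ℚ) := rfl
  exact missingLowerBoundAt_rankOne_additive_of_adjustedIndexBound_of_irr W p K Dt H ι P (hGZ _ W K)
    (hKo _ W K) hKatoI hGZK hmod hr hp2 hadd hj hirr hK hHN hP hμ hLt
    (Cd • W.quadraticTwist (NumberField.discr K : ℚ)) Cd hWd
    (hAsm W p K (Cd • W.quadraticTwist (NumberField.discr K : ℚ)) Cd hr ⟨hp2, hadd, hG, he⟩ hirr hns hK
      hHN hLt hWd)
    (hLsm W p _ K Dt H ι P (Cd • W.quadraticTwist (NumberField.discr K : ℚ)) Cd hr ⟨hp2, hadd, hG, he⟩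
      hirr hns rfl hK hHN hP hWd)

/-! ### §30 The crux BY NAME with the complement shrunk to the REDUCIBLE rows -/

/-- **The crux `GordTwoRankOne` BY NAME, complement = the REDUCIBLE rows only.** PUBLISHED binders
(`hGZ`, `hKo`, `hKatoT`, `hKatoI`, `hGZK`, `hmod`, `hnf`, `hmodP`, `hFH`, `hLLT`) + item 20498 (`hL'`, STEP L′ on
the tower-surjective rows) + `hLsm` (STEP L′ on the small-image rows) + `hAsm` (Conjecture A at the
Friedberg–Hoffstein twists of the small-image rows) + the crux DISPLAYED on the non-CM rows with `E[p]`
REDUCIBLE (`hRed`: X3♯(G-ord) — the Greenberg–Vatsal / A′ road of lane A) ⟹ `GordTwoRankOne`. Rows: CM →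
Li–Liu–Tian; tower-surjective → Part 12 (item 20498); irreducible not tower-surjective → §29; reducible →
displayed. An honest split, not a closure; nothing booked. [cite: JetchevSkinnerWan2017, §7.4.1 (pp. 29–31)]
[cite: LiLiuTian2024, Thm. 1.1 (i)] [cite: CoatesSujatha2005, statement (A)] [cite: Miller2011LMS, Def. 1.1] -/
theorem gordTwoRankOne_of_item_of_smallImage_of_red
    (hGZ : ∀ (N : ℕ) [NeZero N] (W : WeierstrassCurve ℚ) (K : Type) [Field K] [NumberField K],
      gross_zagier N W K)
    (hKo : ∀ (N : ℕ) [NeZero N] (W : WeierstrassCurve ℚ) (K : Type) [Field K] [NumberField K],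
      kolyvagin N W K)
    (hKatoT : Kato2004.rankZero_padicValNat_sha_add_padicValNat_tamagawa_le_of_additive_potGood_of_imageContainsSL2)
    (hKatoI : Kato2004.rankZero_padicValNat_sha_add_padicValNat_tamagawa_le_of_additive_potGood_of_irreducible_of_fineSelmerDual_fg)
    (hGZK : rank_eq_analyticRank_of_analyticRank_le_one) (hmod : hasEntireLFunction_rat)
    (hnf : exists_isNewformOf) (hmodP : nonempty_modularParametrizationData)
    (hFH : friedbergHoffstein_exists_heegnerField_split_twist_ne_zero)
    (hLLT : LiLiuTian2024.thm11_bsdp_of_cm_rank_one)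
    (hL' : AdjustedHeegnerIndexBoundTowerSurj)
    (hLsm : ∀ (W : WeierstrassCurve ℚ) [W.IsElliptic] [W.IsGloballyMinimal] (p : ℕ) [Fact p.Prime]
      (N : ℕ) [NeZero N] (K : Type) [Field K] [NumberField K]
      (Dt : ModularParametrizationData W N) (H : HeegnerDatum N (NumberField.discr K)) (ι : K →+* ℂ)
      (P : (W.baseChange K).toAffine.Point)
      (Wd : WeierstrassCurve ℚ) [Wd.IsElliptic] [Wd.IsGloballyMinimal] (Cd : VariableChange ℚ),
      W.analyticRank = 1 → N10.CellGordTwo W p → W.HasIrreducibleModPGaloisRep p →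
      ¬ (∀ n : ℕ, W.HasSurjectiveModNGaloisRep (p ^ n : ℕ)) →
      W.conductorNorm ℤ = N → IsImaginaryQuadratic K → SatisfiesHeegnerHypothesis N K →
      WeierstrassCurve.Affine.Point.map ι.toRatAlgHom P = heegnerPointComplex Dt H →
      Cd • W.quadraticTwist (NumberField.discr K : ℚ) = Wd →
      Finite (W.baseChange K).sha →
      (2 * padicValNat p (AddSubgroup.zmultiples P).index : ℤ) ≤
        padicValNat p (W.baseChange K).shaOrder + padicValNat p W.tamagawaProduct +
          padicValNat p Wd.tamagawaProduct + 2 * padicValRat p (Dt.c : ℚ))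
    (hAsm : ∀ (W : WeierstrassCurve ℚ) [W.IsElliptic] [W.IsGloballyMinimal] (p : ℕ) [Fact p.Prime]
      (K : Type) [Field K] [NumberField K]
      (Wd : WeierstrassCurve ℚ) [Wd.IsElliptic] [Wd.IsGloballyMinimal] (Cd : VariableChange ℚ),
      W.analyticRank = 1 → N10.CellGordTwo W p → W.HasIrreducibleModPGaloisRep p →
      ¬ (∀ n : ℕ, W.HasSurjectiveModNGaloisRep (p ^ n : ℕ)) →
      IsImaginaryQuadratic K → SatisfiesHeegnerHypothesis (W.conductorNorm ℤ) K →
      (W.quadraticTwist (NumberField.discr K : ℚ)).entireLFunction 1 ≠ 0 →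
      Cd • W.quadraticTwist (NumberField.discr K : ℚ) = Wd →
      ∀ κ : ZpExtension ℚ p, κ.IsCyclotomic →
        ∃ (γ : Field.absoluteGaloisGroup ℚ) (D : Wd.FineSelmerDualData κ γ),
          Module.Finite ℤ_[p] (RestrictScalars ℤ_[p] (IwasawaAlgebra p) D.X))
    (hRed : ∀ (W : WeierstrassCurve ℚ) [W.IsElliptic] [W.IsGloballyMinimal] (p : ℕ) [Fact p.Prime],
      W.analyticRank = 1 → N10.CellGordTwo W p → ¬ W.HasCM →
      ¬ W.HasIrreducibleModPGaloisRep p → Typed.MissingLowerBoundAt W p) :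
    GordTwoRankOne := by
  intro W _ _ p _ hr hc2
  by_cases hcm : W.HasCM
  · exact gordTwoRankOne_cm_of_liLiuTian hLLT W p hr hc2 hcm
  by_cases hsurj : ∀ n : ℕ, W.HasSurjectiveModNGaloisRep (p ^ n : ℕ)
  · exact cellGordTwo_missingLowerBoundAt_rankOne_of_towerSurj_of_item hGZ hKo hKatoT hGZK hmod hnf hmodP hFH
      hL' W p hr hc2 hsurj
  by_cases hirr : W.HasIrreducibleModPGaloisRep p
  · exact cellGordTwo_missingLowerBoundAt_rankOne_of_smallImage_of_adjustedIndexBound_of_conjA hGZ hKo hKatoI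
      hGZK hmod hnf hmodP hFH hLsm hAsm W p hr hc2 hirr hsurj
  · exact hRed W p hr hc2 hcm hirr

end Summit.BirchSwinnertonDyer.BirchSwinnertonDyer.Theorems.AdditiveBranchIMCGordTwoRankOne.HeegnerKolyvagin

end
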